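import Summits.CriticalPhenomena.CardyFormulaZ2.Theorems.CardyIKTransportIKMixedBoxCrossingTransportLinkDefs

/-!
# Stub `stub_linkIsoTraceNorm` (line `defect-closure-exploration`, reshape v5b, crux `IKMixedBoxCrossing`,
# stmt-CriticalPhenomena-5911) — helper file: TRANSFER MATRICES on a path and on a cycle; the KERNEL OF ONE BLOCK

Support file (`--supports stmt-CriticalPhenomena-5911`) for the registered stub `stub_linkIsoTraceNorm : LinkIsoTrace ∧ LinkNorm`
(vocabulary `…TransportLinkDefs.lean`, p135510; paper proof: lead c5 memo `Lines/defect-closure-exploration-c5.md` §9.2).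
* §1 Generic transfer matrices over `ℝ`: entries of an ordered product `(List.ofFn A).prod` are sums over state paths
  (`prod_ofFn_apply`), its trace is the sum over cyclic state sequences (`trace_prod_ofFn`), and a cycle of `k` BLOCKS (block `i`
  with internal states `S i`, a head state, and a kernel depending on its internal state and on the head state of the cyclically
  next block) has total weight the trace of the ordered product of the block matrices (`cycSum_eq_trace`, registered as
  `stub_linkIsoTraceNorm_cycleTrace`).
* §2–§4 One necklace block in the chain variables `η = ξ ⊕ c` (local states `LocSt n`: colour in `Fin 2` and flag at each of the
  `n = r + g` offsets; exit colour = head colour of the next block): weight `wtloc` (`S[η p][η (p+1)] / 2` per face), crossing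
  indicator `crossLoc`, kernel `locK`, block matrix `locMat`.  THE BLOCK KERNEL `locMat_eq` (registered as
  `stub_linkIsoTraceNorm_blockKernel`): `S^(r-1) F_g` (free) / `S^(r-1) G_g(b)` (crossing value `b`) — flags summed face by face and
  colours by the path lemma (`sum_loc_prod`); the crossed kernel is a product of per-face factors (`crossed_eq_prod`) with flag sums
  `S,…,S, DSP, SP,…,SP, SD` (`AX_eq`; `D = diag(1,½)`, `P = diag(0,1)`) and `S^(r-1)(DSP)(SP)^(g-1)(SD) = S^(r-1) u uᵀ` (`prod_AXn`);
  not crossed = free − crossed.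
-/

noncomputable section

namespace Summit.CriticalPhenomena.CardyFormulaZ2.Cruxes.IKMixedBoxCrossing.DefectClosureExploration

open scoped BigOperators Classical
open Finset Matrix

namespace LinkIsoTraceStub

/-! ## §1 Transfer matrices on a path and on a cycle -/

section Generic

variable {α : Type*}

/-- The successor state along a path of `m + 1` states closed by the exit state `b`. -/
def pnx {m : ℕ} (y : Fin (m + 1) → α) (b : α) (p : Fin (m + 1)) : α :=
  if h : p.val + 1 < m + 1 then y ⟨p.val + 1, h⟩ else b

/-- `pnx` of a `Fin.cons` path at `0`. -/
theorem pnx_cons_zero {m : ℕ} (c : α) (y : Fin (m + 1) → α) (b : α) :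
    pnx (Fin.cons c y : Fin (m + 2) → α) b 0 = y 0 := by
  unfold pnx; rw [dif_pos (by simp)]; exact Fin.cons_succ (α := fun _ => α) c y 0

/-- `pnx` of a `Fin.cons` path at a successor. -/
theorem pnx_cons_succ {m : ℕ} (c : α) (y : Fin (m + 1) → α) (b : α) (p : Fin (m + 1)) :
    pnx (Fin.cons c y : Fin (m + 2) → α) b p.succ = pnx y b p := by
  unfold pnx
  simp only [Fin.val_succ]
  split_ifs with h1 h2 h2
  exacts [Fin.cons_succ (α := fun _ => α) c y ⟨p.val + 1, h2⟩, by omega, by omega, rfl]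

variable [Fintype α]

/-- Splitting a sum over paths of length `m + 2` at the first state. -/
theorem sum_cons {m : ℕ} (F : (Fin (m + 2) → α) → ℝ) :
    ∑ y, F y = ∑ c : α, ∑ y : Fin (m + 1) → α, F (Fin.cons c y) := by
  rw [← (Fin.consEquiv fun _ : Fin (m + 2) => α).sum_comp, Fintype.sum_prod_type]
  rfl

variable [DecidableEq α]

/-- PATH LEMMA.  The entries of an ordered product of `m + 1` matrices are sums over the paths of states
(first state the row index, exit state the column index). -/
theorem prod_ofFn_apply : ∀ (m : ℕ) (A : Fin (m + 1) → Matrix α α ℝ) (a b : α),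
    (List.ofFn A).prod a b = ∑ y : Fin (m + 1) → α, if y 0 = a then ∏ p, A p (y p) (pnx y b p) else 0
  | 0, A, a, b => by
    rw [List.ofFn_succ, List.ofFn_zero, List.prod_cons, List.prod_nil, mul_one]
    rw [Fintype.sum_equiv (Equiv.funUnique (Fin 1) α) _ (fun c => if c = a then A 0 c b else 0) ?_]
    · rw [Finset.sum_ite_eq']
      simp
    · intro y
      have h0 : pnx y b 0 = b := by unfold pnx; rw [dif_neg (by omega)]
      rw [Fin.prod_univ_succ, Fin.prod_univ_zero, mul_one, h0]
      simp only [Equiv.funUnique_apply, Fin.default_eq_zero]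
  | m + 1, A, a, b => by
    rw [List.ofFn_succ, List.prod_cons, Matrix.mul_apply, sum_cons]
    symm
    rw [Finset.sum_eq_single a (fun c _ hc => by simp [Fin.cons_zero, hc])
      (fun h => absurd (Finset.mem_univ a) h)]
    simp only [Fin.cons_zero, if_true]
    have ih := prod_ofFn_apply m (fun i => A i.succ)
    simp only [ih, Finset.mul_sum, mul_ite, mul_zero]
    rw [Finset.sum_comm]
    refine Finset.sum_congr rfl fun y _ => ?_
    rw [Finset.sum_ite_eq univ (y 0), if_pos (Finset.mem_univ _)]
    rw [Fin.prod_univ_succ (n := m + 1)]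
    simp only [Fin.cons_zero, Fin.cons_succ, pnx_cons_zero, pnx_cons_succ]

/-- The cyclic successor on `Fin k`. -/
def nxI {k : ℕ} (hk : 0 < k) (i : Fin k) : Fin k := ⟨(i.val + 1) % k, Nat.mod_lt _ hk⟩

/-- CYCLE LEMMA.  The trace of an ordered product of matrices is the sum over the cyclic sequences of states. -/
theorem trace_prod_ofFn {k : ℕ} (hk : 0 < k) (B : Fin k → Matrix α α ℝ) :
    Matrix.trace (List.ofFn B).prod = ∑ y : Fin k → α, ∏ p, B p (y p) (y (nxI hk p)) := by
  obtain ⟨m, rfl⟩ := Nat.exists_eq_succ_of_ne_zero hk.ne'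
  have hnx : ∀ (y : Fin (m + 1) → α) (p : Fin (m + 1)), pnx y (y 0) p = y (nxI hk p) := by
    intro y p
    unfold pnx nxI
    split_ifs with h
    · congr 1
      exact Fin.ext (Nat.mod_eq_of_lt h).symm
    · have hp : p.val + 1 = m + 1 := by omega
      congr 1
      exact Fin.ext (by simp [hp])
  unfold Matrix.trace
  simp only [Matrix.diag_apply, prod_ofFn_apply]
  rw [Finset.sum_comm]
  refine Finset.sum_congr rfl fun y _ => ?_
  rw [Finset.sum_ite_eq univ (y 0), if_pos (Finset.mem_univ _)]
  simp only [hnx]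

/-- CYCLE OF BLOCKS WITH INTERNAL STATES.  Block `i` has internal states `S i`, a head state `hd` and a kernel `K i`
depending on its internal state and on the head state of the next block; the total weight is the trace of the ordered
product of the block matrices (sum of the kernel over the internal states with prescribed head state). -/
theorem cycSum_eq_trace {k : ℕ} (hk : 0 < k) {S : Fin k → Type*} [∀ i, Fintype (S i)]
    (hd : ∀ i, S i → α) (K : ∀ i, S i → α → ℝ) :
    ∑ σ : (∀ i, S i), ∏ i, K i (σ i) (hd _ (σ (nxI hk i))) =
      Matrix.trace (List.ofFn fun i => Matrix.of fun e e' => ∑ s, if hd i s = e then K i s e' else 0).prod := by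
  rw [trace_prod_ofFn hk]
  simp only [Matrix.of_apply]
  simp_rw [Fintype.prod_sum]
  rw [Finset.sum_comm]
  refine Finset.sum_congr rfl fun σ _ => ?_
  simp_rw [Fintype.prod_ite_zero]
  rw [Finset.sum_eq_single (fun i => hd i (σ i))]
  · simp
  · intro y _ hy
    rw [if_neg]
    intro h
    exact hy (funext fun i => (h i).symm)
  · simp

end Generic

/-! ## §2 The kernel of one block (run of length `r`, then gap; `n` offsets in all) -/

/-- Local state of a block of `n` offsets: the chain colour (`Fin 2`; `1` = the new column differs from the presented
one) and the flag at each offset. -/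
abbrev LocSt (n : ℕ) : Type := Fin n → Fin 2 × Bool

/-- Colour at the next offset; after the last offset of the block, the exit colour `e'`. -/
def nxc {n : ℕ} (s : LocSt n) (e' : Fin 2) (p : Fin n) : Fin 2 :=
  if h : p.val + 1 < n then (s ⟨p.val + 1, h⟩).1 else e'

/-- Isotropic weight of the faces of the block: `S[colour p][colour (p + 1)] / 2` per face. -/
def wtloc {n : ℕ} (s : LocSt n) (e' : Fin 2) : ℝ := ∏ p, Smat (s p).1 (nxc s e' p) / 2

/-- The gap of the block (offsets `≥ r`) is CROSSED, in the chain variables: colour `1` on the gap, colour `0` or flag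
`false` at the last run cell `r - 1`, exit colour `0` or flag `true` at the last offset. -/
def crossLoc (r n : ℕ) (s : LocSt n) (e' : Fin 2) : Bool :=
  decide ((∀ p : Fin n, r ≤ p.val → (s p).1 = 1) ∧ (∀ p : Fin n, p.val = r - 1 → ((s p).1 = 0 ∨ (s p).2 = false)) ∧
    (∀ p : Fin n, p.val = n - 1 → (e' = 0 ∨ (s p).2 = true)))

/-- The local kernel: the weight, restricted to the prescribed crossing value `b` unless the block is `free`. -/
def locK (r n : ℕ) (free b : Bool) (s : LocSt n) (e' : Fin 2) : ℝ :=
  if free = true ∨ crossLoc r n s e' = b then wtloc s e' else 0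

/-- The block matrix: the local kernel summed over the local states with prescribed head colour. -/
def locMat (r n : ℕ) (hn : 0 < n) (free b : Bool) : Matrix (Fin 2) (Fin 2) ℝ :=
  Matrix.of fun e e' => ∑ s : LocSt n, if (s ⟨0, hn⟩).1 = e then locK r n free b s e' else 0

/-- Summing per-face factors over the local states with prescribed head colour: first the flags (face by face),
then the colours (path lemma). -/
theorem sum_loc_prod {n : ℕ} (hn : 0 < n) (Φ : Fin n → Fin 2 → Fin 2 → Bool → ℝ) (e e' : Fin 2) :
    (∑ s : LocSt n, if (s ⟨0, hn⟩).1 = e then ∏ p, Φ p (s p).1 (nxc s e' p) (s p).2 else 0) =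
      (List.ofFn fun p => Matrix.of fun a a' => ∑ t : Bool, Φ p a a' t).prod e e' := by
  obtain ⟨m, rfl⟩ := Nat.exists_eq_succ_of_ne_zero hn.ne'
  rw [prod_ofFn_apply]
  rw [← (Equiv.arrowProdEquivProdArrow (Fin (m + 1)) (fun _ => Fin 2) (fun _ => Bool)).symm.sum_comp,
    Fintype.sum_prod_type]
  refine Finset.sum_congr rfl fun y _ => ?_
  have hnx : ∀ (φ : Fin (m + 1) → Bool) (p : Fin (m + 1)),
      nxc ((Equiv.arrowProdEquivProdArrow (Fin (m + 1)) (fun _ => Fin 2) (fun _ => Bool)).symm (y, φ)) e' p =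
        pnx y e' p := fun φ p => rfl
  simp only [hnx]
  change (∑ φ : Fin (m + 1) → Bool, if y 0 = e then ∏ p, Φ p (y p) (pnx y e' p) (φ p) else 0) = _
  by_cases hy : y 0 = e
  · simp only [hy, if_true, Matrix.of_apply]
    exact (Fintype.prod_sum fun p t => Φ p (y p) (pnx y e' p) t).symm
  · simp only [hy, if_false, Finset.sum_const_zero]

/-- The per-face factor of the CROSSED kernel (flag not yet summed): the isotropic weight times the indicator of the
crossing constraints read at this face (`a` colour at `p`, `a'` colour at `p + 1` or exit colour, `t` flag at `p`). -/
def ΦX (r n : ℕ) (p : Fin n) (a a' : Fin 2) (t : Bool) : ℝ :=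
  Smat a a' / 2 * (if (p.val = r - 1 → (a = 0 ∨ t = false)) then 1 else 0) *
    (if (r ≤ p.val + 1 → p.val + 1 < n → a' = 1) then 1 else 0) *
    (if (p.val = n - 1 → (a' = 0 ∨ t = true)) then 1 else 0)

/-- Three indicator factors. -/
theorem ite_and₃ (P Q R : Prop) {_ : Decidable P} {_ : Decidable Q} {_ : Decidable R} {_ : Decidable (Q ∧ P ∧ R)}
    (w : ℝ) :
    (if decide (Q ∧ P ∧ R) = true then w else 0) =
      w * (if P then 1 else 0) * (if Q then 1 else 0) * (if R then 1 else 0) := by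
  by_cases hP : P <;> by_cases hQ : Q <;> by_cases hR : R <;> simp [hP, hQ, hR]

/-- The crossed kernel is the product of its per-face factors. -/
theorem crossed_eq_prod (r n : ℕ) (hr : 1 ≤ r) (s : LocSt n) (e' : Fin 2) :
    (if crossLoc r n s e' = true then wtloc s e' else 0) = ∏ p, ΦX r n p (s p).1 (nxc s e' p) (s p).2 := by
  simp only [ΦX, Finset.prod_mul_distrib, Fintype.prod_boole]
  have h2 : (∀ p : Fin n, r ≤ p.val + 1 → p.val + 1 < n → nxc s e' p = 1) ↔
      (∀ q : Fin n, r ≤ q.val → (s q).1 = 1) := by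
    constructor
    · intro h q hq
      have hq1 : 1 ≤ q.val := le_trans hr hq
      have h' := h ⟨q.val - 1, by omega⟩ (by simp only; omega) (by simp only; omega)
      unfold nxc at h'
      rw [dif_pos (by simp only; omega)] at h'
      rw [← h']
      congr 2
      exact Fin.ext (by simp only; omega)
    · intro h p h1 h3
      unfold nxc
      rw [dif_pos h3]
      exact h ⟨p.val + 1, h3⟩ h1
  have h3 : (∀ p : Fin n, p.val = n - 1 → (nxc s e' p = 0 ∨ (s p).2 = true)) ↔
      (∀ p : Fin n, p.val = n - 1 → (e' = 0 ∨ (s p).2 = true)) := by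
    refine forall_congr' fun p => imp_congr_right fun hp => ?_
    unfold nxc
    rw [dif_neg (by omega)]
  simp only [h2, h3]
  unfold crossLoc wtloc
  exact ite_and₃ _ _ _ _

/-! ## §3 The per-face matrices of the crossed kernel and their ordered product -/

/-- `D S P`: the face from the last run cell into the gap (crossed kernel, flag summed out). -/
def Bm : Matrix (Fin 2) (Fin 2) ℝ := !![0, tI; 0, 1 / 2]

/-- `S P`: a face inside the gap (crossed kernel). -/
def SPm : Matrix (Fin 2) (Fin 2) ℝ := !![0, tI; 0, 1]

/-- `S D`: the top face of the gap (crossed kernel, flag summed out). -/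
def SDm : Matrix (Fin 2) (Fin 2) ℝ := !![1, tI / 2; tI, 1 / 2]

/-- `(D S P)(S P) = D S P` (`S[1][1] = 1`). -/
theorem Bm_mul_SPm : Bm * SPm = Bm := by
  ext i j
  fin_cases i <;> fin_cases j <;> simp [Bm, SPm, Matrix.mul_apply, Fin.sum_univ_two]

/-- `(D S P)(S D) = u uᵀ = M¹`. -/
theorem Bm_mul_SDm : Bm * SDm = M1 := by
  ext i j
  fin_cases i <;> fin_cases j <;>
    simp [Bm, SDm, M1, uvec, Matrix.mul_apply, Fin.sum_univ_two, Matrix.vecMulVec_apply]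

/-- The per-face matrices of the crossed kernel, by position `p` in the block (`r` run cells, `n` offsets). -/
def AXn (r n p : ℕ) : Matrix (Fin 2) (Fin 2) ℝ :=
  if p < r - 1 then Smat else if p = r - 1 then Bm else if p < n - 1 then SPm else SDm

/-- Summing the flag out of the per-face factor of the crossed kernel gives the per-face matrix. -/
theorem AX_eq (r n : ℕ) (hr : 1 ≤ r) (hrn : r < n) (p : Fin n) :
    (Matrix.of fun a a' => ∑ t : Bool, ΦX r n p a a' t) = AXn r n p.val := by
  unfold AXn
  by_cases h1 : p.val < r - 1
  · rw [if_pos h1]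
    ext a a'
    have c1 : (p.val = r - 1) ↔ False := iff_false_intro (by omega)
    have c2 : (r ≤ p.val + 1) ↔ False := iff_false_intro (by omega)
    have c3 : (p.val = n - 1) ↔ False := iff_false_intro (by omega)
    simp only [Matrix.of_apply, Fintype.sum_bool, ΦX, c1, c2, c3, false_implies, if_true, mul_one]
    ring
  rw [if_neg h1]
  by_cases h2 : p.val = r - 1
  · rw [if_pos h2]
    ext a a'
    have c1 : (p.val = r - 1) ↔ True := iff_true_intro h2
    have c2 : (r ≤ p.val + 1) ↔ True := iff_true_intro (by omega)
    have c2' : (p.val + 1 < n) ↔ True := iff_true_intro (by omega)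
    have c3 : (p.val = n - 1) ↔ False := iff_false_intro (by omega)
    simp only [Matrix.of_apply, Fintype.sum_bool, ΦX, c1, c2, c2', c3, true_implies, false_implies, if_true, mul_one]
    fin_cases a <;> fin_cases a' <;> simp [Bm, Smat]
  rw [if_neg h2]
  by_cases h3 : p.val < n - 1
  · rw [if_pos h3]
    ext a a'
    have c1 : (p.val = r - 1) ↔ False := iff_false_intro h2
    have c2 : (r ≤ p.val + 1) ↔ True := iff_true_intro (by omega)
    have c2' : (p.val + 1 < n) ↔ True := iff_true_intro (by omega)
    have c3 : (p.val = n - 1) ↔ False := iff_false_intro (by omega)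
    simp only [Matrix.of_apply, Fintype.sum_bool, ΦX, c1, c2, c2', c3, true_implies, false_implies, if_true, mul_one]
    fin_cases a <;> fin_cases a' <;> simp [SPm, Smat]
    ring
  · rw [if_neg h3]
    ext a a'
    have c1 : (p.val = r - 1) ↔ False := iff_false_intro h2
    have c2' : (p.val + 1 < n) ↔ False := iff_false_intro (by omega)
    have c3 : (p.val = n - 1) ↔ True := iff_true_intro (by omega)
    simp only [Matrix.of_apply, Fintype.sum_bool, ΦX, c1, c2', c3, true_implies, false_implies, implies_true, if_true,
      mul_one]
    fin_cases a <;> fin_cases a' <;> simp [SDm, Smat]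
    ring

/-- `List.ofFn` of a function of the position is a `List.map` over `List.range`. -/
theorem ofFn_eq_range_map {β : Type*} (F : ℕ → β) :
    ∀ n : ℕ, (List.ofFn fun p : Fin n => F p.val) = (List.range n).map F
  | 0 => by simp
  | n + 1 => by
    rw [List.ofFn_succ', List.range_succ, List.map_append, List.map_singleton, List.concat_eq_append]
    simp only [Fin.val_castSucc, Fin.val_last]
    rw [ofFn_eq_range_map F n]

/-- The ordered product of the per-face matrices of the crossed kernel: `S^(r-1) · M¹`
(`r = r' + 1` run cells, `g = g' + 1` gap cells). -/
theorem prod_AXn (r' g' : ℕ) :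
    ((List.range (r' + 1 + (g' + 1))).map (AXn (r' + 1) (r' + 1 + (g' + 1)))).prod = Smat ^ r' * M1 := by
  set A := AXn (r' + 1) (r' + 1 + (g' + 1)) with hA
  have hA1 : ∀ p, p < r' → A p = Smat := fun p hp => by
    rw [hA]; unfold AXn; rw [if_pos (by omega)]
  have hA2 : A r' = Bm := by
    rw [hA]; unfold AXn; rw [if_neg (by omega), if_pos (by omega)]
  have hA3 : ∀ j, j < g' → A (r' + 1 + j) = SPm := fun j hj => by
    rw [hA]; unfold AXn; rw [if_neg (by omega), if_neg (by omega), if_pos (by omega)]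
  have hA4 : A (r' + 1 + g') = SDm := by
    rw [hA]; unfold AXn; rw [if_neg (by omega), if_neg (by omega), if_neg (by omega)]
  have step1 : ∀ j, j ≤ r' → ((List.range j).map A).prod = Smat ^ j := by
    intro j hj
    induction j with
    | zero => simp
    | succ j ih => rw [List.prod_range_succ, ih (by omega), hA1 j (by omega), pow_succ]
  have step3 : ∀ j, j ≤ g' → ((List.range (r' + 1 + j)).map A).prod = Smat ^ r' * Bm := by
    intro j hj
    induction j with
    | zero => rw [Nat.add_zero, List.prod_range_succ, step1 r' le_rfl, hA2]
    | succ j ih =>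
      rw [show r' + 1 + (j + 1) = (r' + 1 + j) + 1 from rfl, List.prod_range_succ, ih (by omega), hA3 j (by omega),
        mul_assoc, Bm_mul_SPm]
  rw [show r' + 1 + (g' + 1) = (r' + 1 + g') + 1 from rfl, List.prod_range_succ, step3 g' le_rfl, hA4, mul_assoc,
    Bm_mul_SDm]

/-! ## §4 The block kernel -/

/-- THE BLOCK KERNEL: `S^(r-1) · F_g` for a free block, `S^(r-1) · G_g(b)` for a block with prescribed crossing value `b`. -/
theorem locMat_eq (r g : ℕ) (hr : 1 ≤ r) (hg : 1 ≤ g) (hn : 0 < r + g) (free b : Bool) :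
    locMat r (r + g) hn free b = Smat ^ (r - 1) * (if free then Fmat g else Gmat g b) := by
  obtain ⟨r', rfl⟩ : ∃ r', r = r' + 1 := ⟨r - 1, by omega⟩
  obtain ⟨g', rfl⟩ : ∃ g', g = g' + 1 := ⟨g - 1, by omega⟩
  simp only [Nat.add_sub_cancel]
  have hfree : ∀ e e' : Fin 2, (∑ s : LocSt (r' + 1 + (g' + 1)), if (s ⟨0, hn⟩).1 = e then wtloc s e' else 0) =
      (Smat ^ (r' + 1 + (g' + 1))) e e' := by
    intro e e'
    have h := sum_loc_prod hn (fun _ a a' _ => Smat a a' / 2) e e'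
    have hS : (Matrix.of fun a a' : Fin 2 => ∑ _t : Bool, Smat a a' / 2) = Smat := by
      ext a a'
      simp only [Matrix.of_apply, Fintype.sum_bool]
      ring
    simp only [hS, List.ofFn_const, List.prod_replicate] at h
    exact h
  have hcross : ∀ e e' : Fin 2, (∑ s : LocSt (r' + 1 + (g' + 1)), if (s ⟨0, hn⟩).1 = e then
      (if crossLoc (r' + 1) (r' + 1 + (g' + 1)) s e' = true then wtloc s e' else 0) else 0) = (Smat ^ r' * M1) e e' := by
    intro e e'
    simp only [crossed_eq_prod (r' + 1) (r' + 1 + (g' + 1)) (by omega)]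
    rw [sum_loc_prod hn]
    have hx : (fun p : Fin (r' + 1 + (g' + 1)) => Matrix.of fun a a' => ∑ t : Bool,
        ΦX (r' + 1) (r' + 1 + (g' + 1)) p a a' t) = fun p => AXn (r' + 1) (r' + 1 + (g' + 1)) p.val :=
      funext fun p => AX_eq _ _ (by omega) (by omega) p
    rw [hx, ofFn_eq_range_map, prod_AXn]
  have hpow : Smat ^ r' * Fmat (g' + 1) = Smat ^ (r' + 1 + (g' + 1)) := by
    rw [Fmat, ← pow_add]
    congr 1
    omega
  ext e e'
  simp only [locMat, locK, Matrix.of_apply]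
  cases free
  · cases b
    · -- not crossed: free minus crossed
      have hsub : ∀ s : LocSt (r' + 1 + (g' + 1)),
          (if (s ⟨0, hn⟩).1 = e then (if false = true ∨ crossLoc (r' + 1) (r' + 1 + (g' + 1)) s e' = false
            then wtloc s e' else 0) else 0) =
          (if (s ⟨0, hn⟩).1 = e then wtloc s e' else 0) - (if (s ⟨0, hn⟩).1 = e then
            (if crossLoc (r' + 1) (r' + 1 + (g' + 1)) s e' = true then wtloc s e' else 0) else 0) := by
        intro s
        cases crossLoc (r' + 1) (r' + 1 + (g' + 1)) s e' <;> split_ifs <;> simp_all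
      simp only [hsub, Finset.sum_sub_distrib, hfree, hcross]
      simp only [Bool.false_eq_true, if_false, Gmat, Matrix.mul_sub, Matrix.sub_apply, hpow]
    · simp only [Bool.false_eq_true, false_or, hcross, if_false, Gmat, if_true]
  · simp only [true_or, if_true, hfree, hpow]

end LinkIsoTraceStub

/-- **Registered helper `stub_linkIsoTraceNorm_cycleTrace`** (stub `stub_linkIsoTraceNorm`, step "close the cycle"): the total
weight of a cycle of blocks with internal states is the trace of the ordered product of the block matrices. -/
theorem stub_linkIsoTraceNorm_cycleTrace : ∀ {k : ℕ} (hk : 0 < k) {S : Fin k → Type} [∀ i, Fintype (S i)]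
    (hd : ∀ i, S i → Fin 2) (K : ∀ i, S i → Fin 2 → ℝ),
    ∑ σ : (∀ i, S i), ∏ i, K i (σ i) (hd _ (σ (LinkIsoTraceStub.nxI hk i))) =
      Matrix.trace (List.ofFn fun i => Matrix.of fun e e' => ∑ s, if hd i s = e then K i s e' else 0).prod :=
  fun hk _ _ hd K => LinkIsoTraceStub.cycSum_eq_trace hk hd K

/-- **Registered helper `stub_linkIsoTraceNorm_blockKernel`** (stub `stub_linkIsoTraceNorm`, the kernel of one block, memo
§9.2): `S^(r-1) · F_g` for a free block, `S^(r-1) · G_g(b)` for a block with prescribed crossing value `b`. -/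
theorem stub_linkIsoTraceNorm_blockKernel : ∀ (r g : ℕ) (hn : 0 < r + g), 1 ≤ r → 1 ≤ g → ∀ (free b : Bool),
    LinkIsoTraceStub.locMat r (r + g) hn free b = Smat ^ (r - 1) * (if free = true then Fmat g else Gmat g b) :=
  fun r g hn hr hg free b => LinkIsoTraceStub.locMat_eq r g hr hg hn free b

end Summit.CriticalPhenomena.CardyFormulaZ2.Cruxes.IKMixedBoxCrossing.DefectClosureExploration

end
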